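import Summits.QuantumFields.YangMills.Theorems.UnitScaleTiltHalvingHSupURhoWindowsTop
import Literature.MathematicalPhysics.QuantumFieldTheory.Balaban1983to89.B8Prop5ContractionKLevel
import HarnessLib

/-!
# `hP1room` PROGRAMME (LEAD-H BOARD «H = hSupUρ»), row (N05-WINDOWS): **THE NUMERIC WINDOWS OF THE TOP-STEP CALL, ALL AT ONCE, FROM ONE SMALLNESS**

Route `UnitScaleTilt`, crux K1 child «MinimiserStabilityRegPr» (stmt-QuantumFields-19200), registered stub `stub_halvingStep` (`BirthV10`).  Cell `ym3-torus`
(HUMAN RULING D-0037: YM₃ on T³ is ladder rung R3 — NOT d = 4, NOT a mass gap, NOT the Clay problem); width seat `ym-t4-w13` g0 (WIDTH COPY of `ym-ust-19200-p2`),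
row named by LEAD-H ★w5-19200 g5 (2026-08-28 16:39Z).  `--supports stmt-QuantumFields-19200 --as helper`; THEOREMS ONLY (0 `def`, 0 `sorry`); count-neutral;
PURE REAL ARITHMETIC — nothing here claims `hSupU`, `hP1room`, the stub, the crux or the gap.

WHAT.  The four consumers of the H-line's top-step call display explicit numeric windows on the letters `α₀ α₁ α₄ cstar(=cs) a C₂ cB cA cDA Cb Cl c' …`:
(a) lit `B8Thm4AtLandau138.thm4_exists_all_levels_landau138` (= the same list in `HalvingP1FlatCoreSupplierInduction.datum_of_preGauge`): `hs₁ hs₂ ha ha2 hα3 hα4 h16 hd5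
hsmall hc₃ hside h50 hC₂ h61`; (b) `HalvingP1FlatCoreSupplierTopCall.topRows_of_datum`: `hα₀9 hcs9 hside hC₂ h61 hsmall₁ hcBlo hcAlo hcDAlo hα3 hα4 hsmall hc₃ hsc hα₃' hs₁ … hs₇
hprod8 hcA' hCblo hCllo hCbρ hClB` and the top windows `hτ ha₁' hb₁' hθ hh₀' h103 h106` (here for every `τ ∈ [0, τ₀]` in place of `‖th‖`); (c) `HalvingP1FlatCoreTopSizes…hX_of_topRows`
(a subset of (a)); (d) `HalvingP1FlatCoreSupplierAssembly.hSupBlock_of_topRows`: `hα hcA hbudget hc₁` (`hc₁` here for every `η ∈ [0, 1]` with `c₁ := η·cstar`); and J3's own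
windows (`HalvingP1FlatCorePreGauge.exists_preGauge_flat`: `hε3 hε2 hsmall`).  ★★ `exists_topCall_constants_of_rhoWindow`: for `d = 3`, `L ≥ 2`, the socket constants
`B₀, B₀'H > 0`, `B₂', BG, BR ≥ 0`, `cB9 > 0`, the member data `M′ ρ′ : ℕ` and `ε₀ > 0` under the ONE smallness
  `10²⁶ · L⁶ · (1 + B₀ + B₀⁻¹)² · ((1 + B₀'H)(1 + B₂')(1 + BG)(1 + BR))⁵ · (1 + cB9⁻¹) · ((ρ′ + M′ + 1)·ε₀) ≤ 1`
there are reals `α₀ α₁ a₆₆ cstar B₀' α₄ C₂ cB cA cDA Cb Cl c' τ₀` — GIVEN BY DISPLAYED DEFINING EQUATIONS (`α₀ = ε₀`, `a₆₆ = 198ε₀ + 12(M′−1+4ρ′)ε₀` (J3 (d) at d = 3),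
`α₁ = 198s + 27s/(L·B₀)`, `s := (ρ′+M′+1)ε₀`, `cstar = 5dLB₀(α₀+α₁)`, `B₀' = B₀'H + 15L²·BG·BR + 3·BG·BR·B₂'`, `α₄ = 8B₀'(5dLB₀)(α₀+α₁)`, `C₂ = 16·(131072(d+1)²)`,
`cB = cA = L·cstar`, `cDA = dL²·cstar`, `Cb`∕`Cl` = the `hCblo`∕`hCllo` floors, `c' = 2cstar`, `τ₀ = 64s`) — satisfying EVERY window above, verbatim in the consumers' letters.

LOCATED DESIGN POINT (memo `LOCATE-N05-WINDOWS-t4w13.md`, 19200 evidence): `B₀'` is an OUTPUT, not a free input — `h103` (`BG·Mc ≤ α₄/4`) with `cDA ≥ dL²cs` and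
`α₄ = 8B₀'(5dLB₀)(α₀+α₁)` is first order on both sides, i.e. the ε₀-free ratio condition `B₀' ≳ d·L²·BG·BR` (print's own choice of `B₀'`, p. 94, (1.103)); in (b) `B₀'`
enters only through `hα₄` and `0 < B₀'`.  Elementary real arithmetic over `UnitScaleTiltHalvingHSupURhoWindowsPrelim` (constants, budgets, sizes, second order) and `…Top` ((1.103), (1.106), drops); the
mathematics is in the cited files.

References: T. Bałaban, CMP **99** (1985) 75–102 [Balaban1985RegularSpaces] (Thm 4 p.88, Prop. 3 p.87, Prop. 5 (1.103)–(1.109) pp.93–94, (1.110)–(1.125) pp.95–97);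
CMP **98** (1985) 17–51 [Balaban1985Averaging] (Prop. 2 (54) p.26, (203)–(214) pp.49–50); CMP **102** (1985) 277–309 [Balaban1985Variational] ((150)–(168) pp.301–304).
-/

set_option autoImplicit false

noncomputable section

namespace Summit.QuantumFields.YangMills.Theorems.HalvingHSupURhoWindows

open Literature.MathematicalPhysics.QuantumFieldTheory.Balaban1983to89
open B7Prop2Explicit (C0 c2')
open B7Prop3Flat (c3)
open B7Prop9Flat (C5')
open B7Prop10General (C6 C4G)
open B8Ineq125Concrete (C2p)
open B8Prop5ContractionKLevel (Mc Kc)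
open HalvingHSupURhoWindowsPrelim HalvingHSupURhoWindowsTop

set_option maxHeartbeats 400000 in
/-- ★★ **ALL NUMERIC WINDOWS OF THE TOP-STEP CALL FROM ONE SMALLNESS** (see the module docstring for the list and the letters; (2) = Theorem 4's windows at
`a := a₆₆`, (3) = `topRows_of_datum`'s scalar windows, (4) = `hSupBlock_of_topRows`' with `hc₁` for every `η ∈ [0,1]` and J3's, (5) = the seven top windows for
every `τ ∈ [0, τ₀]`; `B₀'` is an OUTPUT — located ratio condition of (1.103)).  Stated for a generic `d` with `d = 3`, so that the conjuncts match the consumers'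
`P.d`-letters after `T3Family.P_d`. [cite: Balaban1985RegularSpaces, Thm 4 p.88, Prop. 3 p.87, (1.103) p.93, Prop. 5 p.94, (1.110)-(1.125) pp.95-97; Balaban1985Averaging, (54) p.26, (203)-(214) pp.49-50; Balaban1985Variational, (150)-(168) pp.301-304] -/
theorem exists_topCall_constants_of_rhoWindow (d L : ℕ) (hd : d = 3) (hL : 2 ≤ L)
    {B₀ B₀'H B₂' BG BR cB9 : ℝ} (hB₀ : 0 < B₀) (hB₀'H : 0 < B₀'H) (hB₂' : 0 ≤ B₂') (hBG : 0 ≤ BG) (hBR : 0 ≤ BR) (hcB9 : 0 < cB9)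
    (M' ρ' : ℕ) {ε₀ : ℝ} (hε₀ : 0 < ε₀)
    (hw : (10 : ℝ) ^ 26 * (L : ℝ) ^ 6 * (1 + B₀ + B₀⁻¹) ^ 2 * ((1 + B₀'H) * (1 + B₂') * (1 + BG) * (1 + BR)) ^ 5 * (1 + cB9⁻¹) *
      (((ρ' : ℝ) + M' + 1) * ε₀) ≤ 1) :
    ∃ α₀ α₁ a₆₆ cstar B₀' α₄ C₂ cB cA cDA Cb Cl c' τ₀ : ℝ,
      -- (0) the defining equations
      α₀ = ε₀ ∧ a₆₆ = 198 * ε₀ + 12 * ((M' : ℝ) - 1 + 4 * ρ') * ε₀ ∧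
      α₁ = 198 * (((ρ' : ℝ) + M' + 1) * ε₀) + 27 * (((ρ' : ℝ) + M' + 1) * ε₀) / ((L : ℝ) * B₀) ∧
      cstar = 5 * d * L * B₀ * (α₀ + α₁) ∧ B₀' = B₀'H + 15 * (L : ℝ) ^ 2 * BG * BR + 3 * BG * BR * B₂' ∧
      α₄ = 8 * B₀' * (5 * (d : ℝ) * L * B₀) * (α₀ + α₁) ∧ C₂ = 16 * (131072 * ((d : ℝ) + 1) ^ 2) ∧
      cB = L * cstar ∧ cA = L * cstar ∧ cDA = (d : ℝ) * (L : ℝ) ^ 2 * cstar ∧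
      Cb = C2p d * (40 * d * cB + α₄) * α₄ ∧ Cl = 2 * C2p d * (40 * d * cB + 2 * α₄) ∧ c' = 2 * cstar ∧
      τ₀ = 64 * (((ρ' : ℝ) + M' + 1) * ε₀) ∧
      -- (1) signs and order
      (0 < α₀ ∧ 0 < α₁ ∧ 0 ≤ α₁ ∧ a₆₆ ≤ α₁ ∧ 198 * ε₀ + 12 * ((M' : ℝ) - 1 + 4 * ρ') * ε₀ ≤ a₆₆ ∧ 0 < B₀' ∧ 0 ≤ α₄ ∧ 0 < α₄ ∧
        0 ≤ B₀ ∧ 0 ≤ cstar ∧ 0 ≤ Cb ∧ 0 ≤ Cl ∧ 0 ≤ c' ∧ 0 ≤ cA ∧ 0 < τ₀) ∧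
      -- (2) Theorem 4's windows ((a) = (c)), with `a := a₆₆`
      (α₄ ≤ 1 / 84 ∧ L * cstar ≤ 1 / 12 ∧ a₆₆ ≤ 1 / 4 ∧ 2 * a₆₆ ≤ cstar ∧ C0 d * α₀ ≤ 1 / 3 ∧ 4 * α₀ ≤ c2' d L ∧
        16 * (2 * (L * cstar) + 8 * α₄) ≤ 1 ∧ 5 * (2 * (L * cstar) + 8 * α₄) * ((d : ℝ) - 1) ≤ 4 ∧
        Real.exp (4 * (800 * ((d : ℝ) + 1) ^ 2 * ((d : ℝ) + 4)) * α₀)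
          * (1 + 8 * (131072 * ((d : ℝ) + 1) ^ 2) * (2 * (L * cstar) + 8 * α₄)) ≤ 2 ∧
        2 * (2 * (L * cstar) + 8 * α₄) ≤ c3 d L ∧ 36 * d * B₀ * (2 * (L * cstar) + 8 * α₄) ≤ 1 / 2 ∧
        50 * d * (2 * (L * cstar) + 8 * α₄) ≤ 1 ∧
        8 * (131072 * ((d : ℝ) + 1) ^ 2) * Real.exp (4 * (800 * ((d : ℝ) + 1) ^ 2 * ((d : ℝ) + 4)) * α₀) ≤ C₂ ∧
        2 * (2 * (L * cstar) + 8 * α₄) ^ 2 + 20 * d * α₀ * (2 * (L * cstar) + 8 * α₄)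
          + 2 * C₂ * (2 * (L * cstar) + 8 * α₄) ^ 2 ≤ α₀ + α₁) ∧
      -- (3) `topRows_of_datum`'s scalar windows ((b))
      (α₀ ≤ cB9 ∧ cstar ≤ cB9 ∧ 36 * d * B₀ * cstar ≤ 1 / 2 ∧
        2 * cstar ^ 2 + 20 * d * α₀ * cstar + 2 * C₂ * cstar ^ 2 ≤ α₀ + α₁ ∧ (d : ℝ) * L * α₁ ≤ 1 / 8 ∧
        L * cstar ≤ cB ∧ L * cstar ≤ cA ∧ (d : ℝ) * (L : ℝ) ^ 2 * cstar ≤ cDA ∧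
        Real.exp (4 * (800 * ((d : ℝ) + 1) ^ 2 * ((d : ℝ) + 4)) * α₀) * (1 + 8 * (131072 * ((d : ℝ) + 1) ^ 2) * cB) ≤ 2 ∧
        2 * cB ≤ c3 d L ∧ 2048 * (d : ℝ) * cB ≤ 1 ∧ 40 * d * cB ≤ 1 / 200 ∧
        200 * C6 d * (2 * α₄) ≤ 1 ∧ 12000 * ((d : ℝ) + 1) * L * (2 * α₄) ≤ 1 ∧
        C4G d L * (α₀ + 40 * d * cB + 4 * (2 * α₄)) ≤ 1 ∧
        1024 * ((d : ℝ) + 1) * ((d : ℝ) + 4) * (L : ℝ) ^ 2 * α₀ ≤ 1 ∧ 32 * ((d : ℝ) + 1) ^ 2 * C6 d * (L : ℝ) ^ 2 * α₀ ≤ 1 ∧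
        16 * d * C5' d * C6 d * (L : ℝ) ^ 2 * α₀ ≤ 1 ∧ 8 * d * C6 d * L * α₀ ≤ 1 ∧
        2 * C6 d * (40 * d * cB + 4 * α₄) ≤ 1 / 8 ∧ cA ≤ 1 / 13 ∧
        C2p d * (40 * d * cB + α₄) * α₄ ≤ Cb ∧ 2 * C2p d * (40 * d * cB + 2 * α₄) ≤ Cl ∧
        Cb ≤ α₄ / (2 * B₀'H) ∧ Cl * B₀'H ≤ 1 / 2) ∧
      -- (4) `hSupBlock_of_topRows`' windows ((d)) and J3's
      (α₄ ≤ 1 / 70 ∧ cA ≤ 1 / 12 ∧ 8 * 3800 * ((((d + 2) * L : ℕ) : ℝ)) ^ 2 * c' ≤ 1 ∧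
        (∀ η : ℝ, 0 ≤ η → η ≤ 1 → Real.exp (η * cstar) - 1 ≤ η * c') ∧
        C0 d * (2 * ε₀) ≤ 1 / 3 ∧ 2 * (2 * ε₀) ≤ c2' d L ∧ a₆₆ ≤ 1 / 6) ∧
      -- (5) the seven top windows, for every `τ ∈ [0, τ₀]`
      (∀ τ : ℝ, 0 ≤ τ → τ ≤ τ₀ →
        B₀'H * τ < α₄ / 4 ∧ α₄ / 4 + B₀'H * (Cb + τ) ≤ 1 / 24 ∧ α₄ / 4 + B₀'H * (Cb + τ) ≤ 1 / 140 ∧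
        10 * (α₄ / 4 + B₀'H * (Cb + τ)) * BR ≤ 1 / 2 ∧ B₀'H * (Cb + τ) ≤ 3 * α₄ / 4 ∧
        BG * Mc d BR (α₄ / 4 + B₀'H * (Cb + τ)) cA (B₂' * (Cb + τ)) cDA ≤ α₄ / 4 ∧
        BG * Kc d BR (α₄ / 4 + B₀'H * (Cb + τ)) cA (B₂' * (Cb + τ)) cDA (B₂' * (2 * Cl)) (1 + B₀'H * (2 * Cl)) (1 + B₀'H * (2 * Cl))
          ≤ 1 / 2) := by
  subst hd
  -- letters
  set ℓ : ℝ := (L : ℝ) with hℓdef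
  have hℓ2 : (2 : ℝ) ≤ ℓ := by rw [hℓdef]; exact_mod_cast hL
  have hℓ1 : (1 : ℝ) ≤ ℓ := by linarith only [hℓ2]
  have hℓ0 : (0 : ℝ) ≤ ℓ := by linarith only [hℓ2]
  obtain ⟨s, hs⟩ : ∃ s : ℝ, s = ((ρ' : ℝ) + M' + 1) * ε₀ := ⟨_, rfl⟩
  have hρ0 : (0 : ℝ) ≤ ρ' := Nat.cast_nonneg _
  have hM0 : (0 : ℝ) ≤ M' := Nat.cast_nonneg _
  have hs0 : 0 < s := by rw [hs]; positivity
  have hεs : ε₀ ≤ s := by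
    rw [hs]; have := mul_nonneg (by linarith only [hρ0, hM0] : (0 : ℝ) ≤ (ρ' : ℝ) + M') hε₀.le; linarith only [this]
  obtain ⟨X₀, hX₀⟩ : ∃ X₀ : ℝ, X₀ = 1 + B₀ + B₀⁻¹ := ⟨_, rfl⟩
  obtain ⟨Y, hY⟩ : ∃ Y : ℝ, Y = (1 + B₀'H) * (1 + B₂') * (1 + BG) * (1 + BR) := ⟨_, rfl⟩
  have hBinv0 : 0 < B₀⁻¹ := inv_pos.mpr hB₀
  have hX₀1 : 1 ≤ X₀ := by rw [hX₀]; linarith only [hB₀.le, hBinv0.le]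
  have hX₀0 : 0 ≤ X₀ := by linarith only [hX₀1]
  have hB₀X : B₀ ≤ X₀ := by rw [hX₀]; linarith only [hBinv0.le]
  have hBiX : B₀⁻¹ ≤ X₀ := by rw [hX₀]; linarith only [hB₀.le]
  obtain ⟨hY1, hB₀'HY, hB₂'Y, hBGY, hBRY, hBGBRY, hBGBRBY, hYlow⟩ := Y_letters hB₀'H.le hB₂' hBG hBR hY
  have hY0 : 0 ≤ Y := by linarith only [hY1]
  obtain ⟨c, hc⟩ : ∃ c : ℝ, c = cB9⁻¹ := ⟨_, rfl⟩
  have hc0 : 0 ≤ c := by rw [hc]; exact (inv_pos.mpr hcB9).le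
  have hW : (10 : ℝ) ^ 26 * ℓ ^ 6 * X₀ ^ 2 * Y ^ 5 * (1 + c) * s ≤ 1 := by rw [hX₀, hY, hs, hc]; exact hw
  obtain ⟨hW1, hW3, hW4, hW5, hW6, hs1⟩ := budgets hℓ1 hX₀1 hY1 hc0 hs0.le hW
  -- the output letters (opaque, with defining equations)
  obtain ⟨a₆₆, ha₆₆⟩ : ∃ a : ℝ, a = 198 * ε₀ + 12 * ((M' : ℝ) - 1 + 4 * ρ') * ε₀ := ⟨_, rfl⟩
  obtain ⟨α₁, hα₁⟩ : ∃ a : ℝ, a = 198 * s + 27 * s / (ℓ * B₀) := ⟨_, rfl⟩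
  obtain ⟨cstar, hcs⟩ : ∃ x : ℝ, x = 15 * ℓ * B₀ * (ε₀ + α₁) := ⟨_, rfl⟩
  obtain ⟨B₀', hB₀'⟩ : ∃ b : ℝ, b = B₀'H + 15 * ℓ ^ 2 * BG * BR + 3 * BG * BR * B₂' := ⟨_, rfl⟩
  obtain ⟨α₄, hα₄⟩ : ∃ a : ℝ, a = 8 * B₀' * cstar := ⟨_, rfl⟩
  obtain ⟨C₂, hC₂⟩ : ∃ x : ℝ, x = 33554432 := ⟨_, rfl⟩
  obtain ⟨cB, hcB⟩ : ∃ x : ℝ, x = ℓ * cstar := ⟨_, rfl⟩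
  obtain ⟨cDA, hcDA⟩ : ∃ x : ℝ, x = 3 * ℓ ^ 2 * cstar := ⟨_, rfl⟩
  obtain ⟨Cb, hCb⟩ : ∃ x : ℝ, x = 579944448 * (120 * cB + α₄) * α₄ := ⟨_, rfl⟩
  obtain ⟨Cl, hCl⟩ : ∃ x : ℝ, x = 2 * 579944448 * (120 * cB + 2 * α₄) := ⟨_, rfl⟩
  obtain ⟨τ₀, hτ₀⟩ : ∃ t : ℝ, t = 64 * s := ⟨_, rfl⟩
  obtain ⟨hα₁L, hα₁U, hcsL, hcsU, hcs0, hB₀'L1, hB₀'L2, hB₀'L3, hB₀'U, hB₀'0, hα₄L, hα₄U, hα₄0, hcBU, hcDAU, htU, hQU, hClU, hV0, hcsV⟩ :=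
    sizes hℓ1 hB₀ hX₀1 hB₀X hBiX hY1 hB₀'H hB₂' hBG hBR hYlow hs0 hε₀ hεs hα₁ hcs hB₀' hα₄ hcB hcDA hCl
  have hcB0 : 0 ≤ cB := by rw [hcB]; positivity
  obtain ⟨hCb0, hCbU, hCbρ', h61a, h61b⟩ :=
    second_order hℓ1 hX₀1 hY1 hs0 hε₀ hεs hB₀'HY hα₁L hcs0 hα₄0 hcB0 hα₄U htU hQU hV0 hCb hC₂ hW4 hW5
  obtain ⟨Q, hQ⟩ : ∃ q : ℝ, q = ε₀ + 120 * cB + 8 * α₄ := ⟨_, rfl⟩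
  obtain ⟨hQ11, hQℓ, hQY, hQX, hcsℓ2, hcsℓ1, hcs8, hcsB₀, hcs9, hα9, hε8ℓ, hε8, hℓXs, hs4, h3α₁, hYV, hYV19⟩ :=
    drops hℓ1 hX₀1 hB₀X hY1 hc hcB9 hs0 hε₀ hεs hW1 hW3 hW4 hcs0 hcsL hcsU hα₁U hcB0 hα₄0 hQ (by rw [hQ]; exact hQU)
  set V : ℝ := ℓ ^ 3 * X₀ * Y * s with hV
  have hVnn : 0 ≤ V := by positivity
  have hcDA0 : 0 ≤ cDA := by rw [hcDA]; positivity
  have hCl0 : 0 ≤ Cl := by rw [hCl]; positivity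
  have hQ0 : 0 ≤ Q := by rw [hQ]; positivity
  -- numerals of the constants
  have hC0 := C0_three
  have hc2' := c2'_three L
  have hc3 := c3_three L
  have hC6 := C6_three
  have hC5' := C5'_three
  have hC4G := C4G_three L
  have hC2p := C2p_three
  have hℓsq0 : 0 < 14336 * ℓ ^ 2 := by positivity
  have hℓ512 : 0 < 512 * ℓ := by positivity
  -- handy products
  set t : ℝ := 2 * (ℓ * cstar) + 8 * α₄ with htdef
  have ht0 : 0 ≤ t := by positivity
  have htQ : t ≤ Q := by rw [htdef, hQ, ← hcB]; linarith only [hε₀, hcB0]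
  have hα₄Q : 8 * α₄ ≤ Q := by rw [hQ]; linarith only [hε₀, hcB0]
  have hcBQ : 120 * cB ≤ Q := by rw [hQ]; linarith only [hε₀, hα₄0]
  have hℓt : ℓ * t ≤ ℓ * Q := mul_le_mul_of_nonneg_left htQ hℓ0
  have hXt : X₀ * t ≤ X₀ * Q := mul_le_mul_of_nonneg_left htQ hX₀0
  have hB₀t : B₀ * t ≤ X₀ * t := mul_le_mul_of_nonneg_right hB₀X ht0
  have hℓcB : ℓ * (120 * cB) ≤ ℓ * Q := mul_le_mul_of_nonneg_left hcBQ hℓ0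
  have hℓα₄ : ℓ * (8 * α₄) ≤ ℓ * Q := mul_le_mul_of_nonneg_left hα₄Q hℓ0
  have hBRα₄ : BR * (8 * α₄) ≤ Y * Q := mul_le_mul hBRY hα₄Q (by positivity) hY0
  have hℓℓ : ℓ ≤ ℓ ^ 2 := by nlinarith only [hℓ1]
  have hℓε : ℓ * ε₀ ≤ ℓ ^ 2 * ε₀ := mul_le_mul_of_nonneg_right hℓℓ hε₀.le
  have ha66U : a₆₆ ≤ 198 * s := by
    rw [ha₆₆, hs]
    have e1 := mul_nonneg hM0 hε₀.le
    have e2 := mul_nonneg hρ0 hε₀.le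
    linarith only [e1, e2, hε₀]
  have hClB : Cl * B₀'H ≤ 1 / 2 := by
    have e := mul_le_mul hClU hB₀'HY hB₀'H.le (by positivity)
    linarith only [e, hYV]
  have hα₄1 : α₄ ≤ 1 := by linarith only [hα₄Q, hQ11]
  -- assemble
  refine ⟨ε₀, α₁, a₆₆, cstar, B₀', α₄, C₂, cB, cB, cDA, Cb, Cl, 2 * cstar, τ₀, rfl, ha₆₆, ?_, ?_, hB₀', ?_, ?_, hcB, hcB, ?_, ?_, ?_, rfl,
    ?_, ⟨hε₀, by linarith only [hα₁L, hs0], by linarith only [hα₁L, hs0], by linarith only [ha66U, hα₁L], le_of_eq ha₆₆.symm, hB₀'0,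
      hα₄0.le, hα₄0, hB₀.le, hcs0.le, hCb0, hCl0, by positivity, hcB0, by rw [hτ₀]; positivity⟩, ?_, ?_, ?_, ?_⟩
  · rw [hα₁, hs]
  · rw [hcs]; push_cast; ring
  · rw [hα₄, hcs]; push_cast; ring
  · rw [hC₂]; norm_num
  · rw [hcDA]; push_cast; ring
  · rw [hCb, hC2p]; push_cast; ring
  · rw [hCl, hC2p]; push_cast; ring
  · rw [hτ₀, hs]
  · -- (2) Theorem 4's windows
    refine ⟨by linarith only [hα₄Q, hQ11], by rw [← hcB]; linarith only [hcBQ, hQ11], by linarith only [ha66U, hs4],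
      by linarith only [ha66U, hcsL, hs0], ?_, ?_, by linarith only [htQ, hQ11], by push_cast; linarith only [htQ, hQ11], ?_, ?_, ?_,
      by push_cast; linarith only [htQ, hQ11], ?_, by push_cast; linarith only [h61a]⟩
    · rw [hC0]; linarith only [hε8]
    · rw [hc2', le_div_iff₀ hℓsq0]; linarith only [hε8ℓ]
    · push_cast; exact hsmall_window hε₀.le hε8 ht0 (by linarith only [htQ, hQ11])
    · rw [hc3, le_div_iff₀ hℓ512]; linarith only [hℓt, hQℓ]
    · push_cast; linarith only [hB₀t, hXt, hQX]
    · push_cast; rw [hC₂]; exact hC2_window hε₀.le hε8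
  · -- (3) `topRows_of_datum`'s scalar windows
    refine ⟨hα9, hcs9, by push_cast; linarith only [hcsB₀], by push_cast; linarith only [h61b], by push_cast; linarith only [h3α₁],
      le_of_eq hcB.symm, le_of_eq hcB.symm, ?_, ?_, ?_, by push_cast; linarith only [hcBQ, hQ11], by push_cast; linarith only [hcBQ, hQ11],
      ?_, ?_, ?_, ?_, ?_, ?_, ?_, ?_, by linarith only [hcBQ, hQ11], ?_, ?_, ?_, hClB⟩
    · rw [hcDA]; push_cast; exact le_rfl
    · push_cast; exact hsmall_window hε₀.le hε8 hcB0 (by linarith only [hcBQ, hQ11])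
    · rw [hc3, le_div_iff₀ hℓ512]; linarith only [hℓcB, hQℓ]
    · rw [hC6]; linarith only [hα₄Q, hQ11]
    · push_cast; linarith only [hℓα₄, hQℓ]
    · rw [hC4G]; push_cast
      have e := mul_nonneg hℓ0 hQ0
      have hQ' : ε₀ + 40 * 3 * cB + 4 * (2 * α₄) = Q := by rw [hQ]; ring
      rw [hQ']
      linarith only [hQℓ, hQ11, e]
    · push_cast; linarith only [hε8ℓ]
    · push_cast; rw [hC6]; linarith only [hε8ℓ]
    · push_cast; rw [hC5', hC6]; linarith only [hε8ℓ]
    · push_cast; rw [hC6]; linarith only [hℓε, hε8ℓ]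
    · rw [hC6]; push_cast; linarith only [hcBQ, hα₄Q, hQ11]
    · rw [hC2p, hCb]; push_cast; exact le_of_eq (by ring)
    · rw [hC2p, hCl]; push_cast; exact le_of_eq (by ring)
    · rw [le_div_iff₀ (by positivity : (0 : ℝ) < 2 * B₀'H)]; linarith only [hCbρ']
  · -- (4) `hSupBlock_of_topRows`' windows and J3's
    refine ⟨by linarith only [hα₄Q, hQ11], by linarith only [hcBQ, hQ11], ?_,
      fun η hη0 hη1 => exp_mul_sub_one_le hη0 hη1 hcs0.le (by linarith only [hcs8]), by rw [hC0]; linarith only [hε8],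
      by rw [hc2', le_div_iff₀ hℓsq0]; linarith only [hε8ℓ], by linarith only [ha66U, hs4]⟩
    push_cast; linarith only [hcsℓ2]
  · -- (5) the seven top windows
    intro τ hτ0 hττ₀
    have hτs : τ ≤ 64 * s := by rw [hτ₀] at hττ₀; exact hττ₀
    have hBs : 0 < B₀'H * s := mul_pos hB₀'H hs0
    have hBτ : B₀'H * τ ≤ α₄ / 4 - B₀'H * s := by
      rw [le_sub_iff_add_le, le_div_iff₀ (by norm_num : (0 : ℝ) < 4)]
      have e1 := mul_le_mul_of_nonneg_left hτs hB₀'H.le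
      have e2 := mul_le_mul_of_nonneg_left hB₀'L1 hs0.le
      linarith only [e1, e2, hα₄L, hBs]
    have hBτ' : B₀'H * τ ≤ α₄ / 4 := by linarith only [hBτ, hBs]
    have hQY' : 10 ^ 11 * Y * (120 * cB + 8 * α₄) ≤ 1 := by
      have e := mul_le_mul_of_nonneg_left (by rw [hQ]; linarith only [hε₀] : 120 * cB + 8 * α₄ ≤ Q) hY0
      linarith only [e, hQY]
    refine ⟨by linarith only [hBτ, hBs], by linarith only [hBτ', hCbρ', hα₄Q, hQ11], by linarith only [hBτ', hCbρ', hα₄Q, hQ11], ?_,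
      by linarith only [hBτ', hCbρ'], ?_, ?_⟩
    · have e : (α₄ / 4 + B₀'H * (Cb + τ)) * BR ≤ α₄ * Y :=
        mul_le_mul (by linarith only [hBτ', hCbρ']) hBRY hBR hα₄0.le
      linarith only [e, hBRα₄, hQY, mul_le_mul_of_nonneg_left hα₄Q hY0]
    · exact top103 hBG hBR hB₂' hB₀'H hY0 hBGBRY hBGBRBY hs0 hcs0 hα₄0 hcB0 hcDA hα₄ hB₀'L2 hB₀'L3 hα₄L hCb hCb0 hCbρ' hQY' hτ0 hτs hBτ'
    · have hYV4 : 10 ^ 18 * Y ^ 4 * V ≤ 1 := by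
        have : Y ^ 4 * V = ℓ ^ 3 * X₀ * Y ^ 5 * s := by rw [hV]; ring
        rw [mul_assoc, this]; linarith only [hW6]
      exact top106 hBR hB₂' hB₀'H hY1 hB₂'Y hBGY hBRY hs0 hV0 hα₄0 hα₄1 hα₄U hcB0 hcBU hcDA0 hcDAU hCb0 hCbU hCbρ' hCl0 hClU hClB hYV4
        hτ0 hτs hBτ'

end Summit.QuantumFields.YangMills.Theorems.HalvingHSupURhoWindows

end
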